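import Summits.QuantumFields.BalabanUV.T4Continuum.Support.B13StepEndInsOp
import Summits.QuantumFields.BalabanUV.T4Continuum.Support.OutputRateArithmetic

/-!
# NE5 ∕ U3 — the termwise END faces on the assembled step model ∕ on the carriers OF RECORD with the two ARITHMETIC
# leaves L10 (reach scale `k₀`, first-scales constant `B`) and L11 (reach `ρ₀`, rate window) ELIMINATED, sharply, and
# the resulting constant `C₅` shown UNIFORM in the pair of runs (row O6-n FOLLOWER on the model of record; typer
# `t4/formal/NE5/DAG.md` leaves L10∕L11; claim table `t4/b2b-balaban-t4-ne5-p1/O1-CLAIM-TABLE-NE5-P1.md` row O6-n)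

Cell `pub-balaban`, unit `b2b-balaban-t4-ne5-formalise-leaf-10-g3` (NE5 formalisation swarm, LEAF PROVER 10, gen 3; the
lineage's row O6-n NUMERICS is `Support/OutputRateArithmetic` p207722, its END application with W4 produced is
`Support/B13StepEndInsOp` p209302).  This module imports `B13StepEndInsOp` (hence `B13StepEnd`, `B13StepOfRecord`) and
`OutputRateArithmetic` BY NAME and edits nothing; no END-face module of the row owner is touched (a NEW module APPLYING landed
END faces, as `B13StepEnd` ∕ `B13StepEndInsOp`).  Summits-side new work under the LEAN PLACEMENT RULE (cell bookkeeping; NOT a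
Literature module).  HONEST FRAMING: rung (B)+1 of the FINITE-VOLUME T⁴ continuum programme — NOT infinite volume, NOT a mass
gap, NOT the Clay problem, and **NOT A PROOF OF NE5** (NOT PRINTED in [Balaban1987RG1]–[Balaban1989LargeFieldII], which print
ε-UNIFORM bounds, never η-RATES; cell GAPS G-t4-U3-1): every END face below is an IMPLICATION whose analytic wall binders
(reading, one-run slice budgets, one-run levels, row NE2's entry rate, W4 or the insertion species' data, the termwise W2 data,
room) are DISPLAYED HYPOTHESES, asserted nowhere.  HONEST DEPENDENCY (cell line, verbatim): continuum YM on T⁴ ⇐ BetaPertH ∧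
nine spine estimates (0/9 proved); BetaPertH ⇐ (D1) ∧ (D4) ∧ CAP+tail; G-an2-4 gates asym, D1 and NE2/3/4.

WHAT THIS FILE DOES (arithmetic + compositions BY NAME; no analytic estimate of its own).
* §1 ARITHMETIC OF THE LETTERS.  The landed END faces carry five arithmetic binders over three auxiliary letters: the reach
  `ρ₀ < 1`, the near hypothesis `D·θ^{k₀} + cA(EA₀ + E₀)∕(1 − ω) ≤ ρ₀` at a reach scale `k₀`, the first-scales constant
  `0 ≤ B` with `EA₀ + E₀ ≤ B·θ^k (k < k₀)`, and the smallness `ω + G∕(1 − ρ₀)·cA < θ′`.  `reach_gain_elim_iff` ∕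
  `arithmetic_letters_iff`: for `D ≥ 0`, `0 < θ < 1`, `G·cA ≥ 0`, `ω < 1` these binders are JOINTLY SATISFIABLE (by some
  `ρ₀, k₀, B`) IFF the two strict size inequalities `cA(EA₀ + E₀) < 1 − ω` and
  `ω + G·cA·(1 − ω)∕(1 − ω − cA(EA₀ + E₀)) < θ′` hold — the elimination is SHARP (the value at the minimal reach is optimal,
  as in `OutputRateArithmetic.reach_smallness_at_iff`); `insReach_exists`: the insertion species' reach `δI·θ^{k₁} ≤ ½`.
* §2 ON THE ASSEMBLED MODEL (any `𝔄 : B13Represents.Assembly`): `exists_ne5_of_assembly` ∕ `_opRate` ∕ `_insOp` — the END faces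
  `B13StepEnd.ne5_of_assembly` ∕ `ne5_of_assembly_opRate` ∕ `B13StepEndInsOp.ne5_of_assembly_insOp` with the letters `ρ₀, k₀, B`
  (and `ρ₁, k₁` of the insertion species; the free reference level `E₁` is set to `1`) NO LONGER HYPOTHESES: inputs `0 < θ < 1`,
  `θ ≤ θ′ ≤ 1` and the two strict size inequalities; conclusion `∃ C₅, T4OutputRate.NE5 outA outB W κ θ′ C₅` at the PRESCRIBED rate `θ′`.
* §3 ON BAŁABAN's CARRIERS OF RECORD, UNIFORMLY: `uniform_ne5_of_record` ∕ `uniform_ne5_of_record_insOp` — ONE constant `C₅`,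
  chosen from the displayed SIZES ONLY (`κ` aside: `G, EA₀, E₀, cA, c₁, r₀, δ′` or `Gi, δI`, `θ, θ′, ω`), serves EVERY pair of runs
  `R : B13Carriers.TwoRuns 𝔾`, every slot package `S : B13StepOfRecord.Slots R E IOp Hist` with `S.D.ω = ω`, every window and
  every roomy class: `∃ C₅, ∀ R S W …, ⟨displayed analytic binders⟩ → NE5 (outA S E₀ cB) (outB S E₀ cB) W κ θ′ C₅` — the
  η-UNIFORMITY of the constant that node U3's consumers need, visible in the quantifier order; per-pair corollaries
  `exists_ne5_of_record` ∕ `exists_ne5_of_record_insOp` (SOME rate `θ′ < 1` instead of a prescribed one: feed the room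
  `ω + G·cA·(1 − ω)∕(1 − ω − cA(EA₀ + E₀)) < 1` through `OutputRateArithmetic.rate_window_iff` first).
So the DISPLAYED census for NE5 on the model of record reads, after this file: the reading `TransportReads`; the two ONE-RUN
slice budgets (W3-KIND); the one-run levels `DecayBound outA∕outB` (L05∕L06 SHAPES, [Balaban1987RG1] (1.18) p. 263 — KIND);
`RawBounded` ×2 + row NE2's `WeightedEntrywiseRate` + margin floor (or `OperatorRate`); W4 `InsertionRate δ′` or the insertion
species' envelope + bound + rate; the termwise W2 data on the roomy class (wall O2); room ×2; signs; `0 < θ < 1`, `θ ≤ θ′ ≤ 1`;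
and the TWO STRICT SIZE INEQUALITIES above — no `ρ₀ ∕ k₀ ∕ B ∕ ρ₁ ∕ k₁` letter is left.  Whether Bałaban's constants satisfy the
two inequalities is NOT decidable from print (every letter O(1)-symbolic: census `B13SmallnessCensus.md` of this lineage).
Nothing of the manuscripts under audit is asserted; 0 sorry; no new axioms.
-/

noncomputable section

open Metric Set

namespace Summit.QuantumFields.BalabanUV.T4Continuum.B13StepEndArithmetic

open Literature.MathematicalPhysics.QuantumFieldTheory.Balaban1983to89
open Literature.MathematicalPhysics.QuantumFieldTheory.Balaban1983to89.T4OutputRate (Carriers Functional DecayBound NE5)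
open Literature.MathematicalPhysics.QuantumFieldTheory.Balaban1983to89.T4InputCauchyRateData (StepModel)
open Literature.MathematicalPhysics.QuantumFieldTheory.Balaban1983to89.T4InputCauchyRateSpecies (ballClass)
open Literature.MathematicalPhysics.QuantumFieldTheory.Balaban1983to89.T4InputCauchyRateTermwise
  (TermBound TermBudget TermLineAnalytic)
open Summit.QuantumFields.BalabanUV.T4Continuum.B13Carriers (TwoRuns)
open Summit.QuantumFields.BalabanUV.T4Continuum.B13OpDatum (OpDatum)
open Summit.QuantumFields.BalabanUV.T4Continuum.B13OpDatumJunctions (RawBounded WeightedEntrywiseRate)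
open Summit.QuantumFields.BalabanUV.T4Continuum.B13StepTermLabels (TermIdx InnerLabel)
open Summit.QuantumFields.BalabanUV.T4Continuum.B13StepTermFamily (term)
open Summit.QuantumFields.BalabanUV.T4Continuum.B13InnerData (Bnd)
open Summit.QuantumFields.BalabanUV.T4Continuum.B13Base (selfCtr)
open Summit.QuantumFields.BalabanUV.T4Continuum.B13Represents (Assembly)
open Summit.QuantumFields.BalabanUV.T4Continuum.B13StepEnd (ne5_of_assembly ne5_of_assembly_opRate)
open Summit.QuantumFields.BalabanUV.T4Continuum.B13StepEndInsOp
  (insertionRate_of_insOp deltaIns_nonneg ne5_of_assembly_insOp)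
open Summit.QuantumFields.BalabanUV.T4Continuum.B13StepOfRecord (Slots assembly step outA outB)
open Summit.QuantumFields.BalabanUV.T4Continuum.OutputRateArithmetic
  (reach_scale_exists reach_binders_exists gain_div_mono)

/-! ## §1 Arithmetic of the letters `ρ₀`, `k₀`, `B` (and `ρ₁`, `k₁`) -/

section Letters

/-- [folklore] **ELIMINATION OF THE REACH `ρ₀` (sharp).**  For a gain numerator `x ≥ 0`: SOME reach `ρ₀` strictly between the
fed-back level `h` and `1` puts the smallness value `ω + x∕(1 − ρ₀)` below the target `t` IFF `h < 1` and the value AT `h`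
itself is below `t` (the value is increasing in `ρ₀`; witness `1 − ρ₀ :=` the midpoint of `x∕(t − ω)` and `1 − h`). -/
theorem reach_gain_elim_iff {h x ω t : ℝ} (hx : 0 ≤ x) :
    (∃ ρ₀, h < ρ₀ ∧ ρ₀ < 1 ∧ ω + x / (1 - ρ₀) < t) ↔ (h < 1 ∧ ω + x / (1 - h) < t) := by
  constructor
  · rintro ⟨ρ₀, h1, h2, h3⟩
    exact ⟨h1.trans h2, lt_of_le_of_lt (by linarith [gain_div_mono hx h1.le h2]) h3⟩
  · rintro ⟨h1, h2⟩
    have h1h : 0 < 1 - h := sub_pos.mpr h1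
    have hxu : x / (1 - h) < t - ω := by linarith
    have hu0 : 0 < t - ω := lt_of_le_of_lt (div_nonneg hx h1h.le) hxu
    have hx' : x < (1 - h) * (t - ω) := by
      have := (div_lt_iff₀ h1h).mp hxu
      linarith
    have hq : x / (t - ω) < 1 - h := by
      rw [div_lt_iff₀ hu0]
      linarith
    have hq0 : 0 ≤ x / (t - ω) := div_nonneg hx hu0.le
    have hpos : 0 < (x / (t - ω) + (1 - h)) / 2 := by linarith
    refine ⟨1 - (x / (t - ω) + (1 - h)) / 2, by linarith, by linarith, ?_⟩
    have hmid : x / (t - ω) < (x / (t - ω) + (1 - h)) / 2 := by linarith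
    have hlt : x < (x / (t - ω) + (1 - h)) / 2 * (t - ω) := by
      have := mul_lt_mul_of_pos_right hmid hu0
      rwa [div_mul_cancel₀ x hu0.ne'] at this
    have hval : x / (1 - (1 - (x / (t - ω) + (1 - h)) / 2)) < t - ω := by
      rw [show (1 : ℝ) - (1 - (x / (t - ω) + (1 - h)) / 2) = (x / (t - ω) + (1 - h)) / 2 by ring, div_lt_iff₀ hpos]
      linarith
    linarith

/-- [folklore] The fed-back level and the smallness value in the END faces' letters: with `h := c·S∕(1 − ω)` (`S = EA₀ + E₀`) and
`ω < 1`, `h < 1 ↔ c·S < 1 − ω` and `x∕(1 − h) = x·(1 − ω)∕(1 − ω − c·S)`. -/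
theorem level_rewrite {c S ω x : ℝ} (hω1 : ω < 1) :
    (c * S / (1 - ω) < 1 ↔ c * S < 1 - ω) ∧ x / (1 - c * S / (1 - ω)) = x * (1 - ω) / (1 - ω - c * S) := by
  have h1ω : 0 < 1 - ω := sub_pos.mpr hω1
  refine ⟨div_lt_one h1ω, ?_⟩
  rw [one_sub_div h1ω.ne', div_div_eq_mul_div]

/-- [folklore] **ELIMINATION OF `ρ₀` IN THE END FACES' LETTERS (sharp).**  With gain numerator `x ≥ 0` (= `G·cA`) and `ω < 1`:
SOME reach `ρ₀ ∈ (cA(EA₀ + E₀)∕(1 − ω), 1)` with `ω + x∕(1 − ρ₀) < θ′` exists IFF `cA(EA₀ + E₀) < 1 − ω` and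
`ω + x·(1 − ω)∕(1 − ω − cA(EA₀ + E₀)) < θ′`. -/
theorem reach_elim_iff {c EA₀ E₀ ω x t : ℝ} (hx : 0 ≤ x) (hω1 : ω < 1) :
    (∃ ρ₀, c * (EA₀ + E₀) / (1 - ω) < ρ₀ ∧ ρ₀ < 1 ∧ ω + x / (1 - ρ₀) < t) ↔
      (c * (EA₀ + E₀) < 1 - ω ∧ ω + x * (1 - ω) / (1 - ω - c * (EA₀ + E₀)) < t) := by
  obtain ⟨h1, h2⟩ := level_rewrite (c := c) (S := EA₀ + E₀) (x := x) hω1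
  rw [reach_gain_elim_iff hx, h1, h2]

/-- [folklore] **THE FIVE ARITHMETIC BINDERS OF THE END FACES ARE JOINTLY SATISFIABLE IFF TWO STRICT SIZE INEQUALITIES HOLD**
(leaves L10 + L11 decided together, sharply; the binders below are LITERALLY `hρ₀`, `hB`, `hnear`, `hfirst`, `hsmall` of
`B13StepEnd.ne5_of_assembly` with `D := c₁∕r₀ + δ′`).  For an input-rate constant `D ≥ 0` at a rate `0 < θ < 1`, `G, cA ≥ 0` and
`ω < 1`: some reach `ρ₀ < 1`, reach scale `k₀` and first-scales constant `B ≥ 0` with the near hypothesis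
`D·θ^{k₀} + cA(EA₀ + E₀)∕(1 − ω) ≤ ρ₀`, the first scales `EA₀ + E₀ ≤ B·θ^k (k < k₀)` and the smallness `ω + G∕(1 − ρ₀)·cA < θ′`
exist IFF `cA(EA₀ + E₀) < 1 − ω` and `ω + G·cA·(1 − ω)∕(1 − ω − cA(EA₀ + E₀)) < θ′`. -/
theorem arithmetic_letters_iff {D θ cA EA₀ E₀ ω G t : ℝ} (hD : 0 ≤ D) (hθ0 : 0 < θ) (hθ1 : θ < 1) (hG : 0 ≤ G) (hcA : 0 ≤ cA)
    (hω1 : ω < 1) :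
    (∃ ρ₀ : ℝ, ∃ k₀ : ℕ, ∃ B : ℝ, ρ₀ < 1 ∧ 0 ≤ B ∧ D * θ ^ k₀ + cA * (EA₀ + E₀) / (1 - ω) ≤ ρ₀ ∧
        (∀ k < k₀, EA₀ + E₀ ≤ B * θ ^ k) ∧ ω + G / (1 - ρ₀) * cA < t) ↔
      (cA * (EA₀ + E₀) < 1 - ω ∧ ω + G * cA * (1 - ω) / (1 - ω - cA * (EA₀ + E₀)) < t) := by
  simp only [div_mul_eq_mul_div]
  rw [← reach_elim_iff (mul_nonneg hG hcA) hω1]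
  constructor
  · rintro ⟨ρ₀, k₀, B, hρ₀, -, hnear, -, hs⟩
    have hle : cA * (EA₀ + E₀) / (1 - ω) ≤ ρ₀ := by linarith [mul_nonneg hD (pow_pos hθ0 k₀).le]
    rcases hle.eq_or_lt with heq | hlt
    · obtain ⟨ρ₁, h1, h2, h3⟩ := (reach_gain_elim_iff (mul_nonneg hG hcA)).mpr ⟨heq ▸ hρ₀, heq ▸ hs⟩
      exact ⟨ρ₁, h1, h2, h3⟩
    · exact ⟨ρ₀, hlt, hρ₀, hs⟩
  · rintro ⟨ρ₀, hreach, hρ₀, hs⟩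
    obtain ⟨k₀, B, hB, hnear, hfirst⟩ := reach_binders_exists hD hθ0 hθ1 hreach
    exact ⟨ρ₀, k₀, B, hρ₀, hB, hnear, hfirst, hs⟩

/-- [folklore] The insertion species' reach at `ρ₁ = ½`: for `δI ≥ 0` and `θ < 1` some `k₁` has `δI·θ^{k₁} ≤ ½`. -/
theorem insReach_exists {δI θ : ℝ} (hδI : 0 ≤ δI) (hθ1 : θ < 1) : ∃ k₁ : ℕ, δI * θ ^ k₁ ≤ 1 / 2 := by
  obtain ⟨k₁, hk₁⟩ := reach_scale_exists (h := 0) (ρ₀ := 1 / 2) hδI hθ1 (by norm_num)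
  exact ⟨k₁, by simpa using hk₁⟩

/-- [folklore] The END faces' smallness binder from the eliminated form: `ω + G∕(1 − ρ₀)·cA = ω + (G·cA)∕(1 − ρ₀)`. -/
theorem smallness_of_gain {ω G cA ρ₀ t : ℝ} (hs : ω + G * cA / (1 - ρ₀) < t) : ω + G / (1 - ρ₀) * cA < t := by
  rwa [div_mul_eq_mul_div]

end Letters

/-! ## §2 The END faces on the assembled model with the letters eliminated -/

section Assembled

variable {C : Carriers} {E IOp Hist ι P J : Type*} [NormedAddCommGroup Hist] [NormedSpace ℂ Hist]
  (𝔄 : Assembly C E IOp Hist ι P J)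

/-- [folklore] **THE TERMWISE END FACE ON THE ASSEMBLED MODEL, ARITHMETIC LETTERS ELIMINATED** — `B13StepEnd.ne5_of_assembly`
(W1 in row NE2's entry currency, W4 displayed as `InsertionRate δ′`) with its binders `hρ₀`, `hnear`, `hB`, `hfirst`, `hsmall`
over the letters `ρ₀, k₀, B` REPLACED by `0 < θ < 1` and the two strict size inequalities `cA(EA₀ + E₀) < 1 − ω`,
`ω + G·cA·(1 − ω)∕(1 − ω − cA(EA₀ + E₀)) < θ′` (§1: nothing lost); every analytic binder BY NAME and unchanged.  Conclusion:
NE5 at the PRESCRIBED rate `θ′` with SOME constant.  NOT a proof of NE5: an implication from displayed binders. -/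
theorem exists_ne5_of_assembly {W : Set (ℕ → ℝ)} {ROp RHist : ℕ → ℝ} {a : ℕ → ι → ℝ}
    {κ G EA₀ E₀ cA cB c₁ r₀ δ' θ θ' : ℝ}
    (hT : 𝔄.TransportReads W)
    (hbB : 𝔄.SliceBudgetB W κ cB) (hbA : 𝔄.D.SliceBudget (𝔄.step (𝔄.bHist E₀ cB)) W κ cA)
    (hdA : DecayBound (𝔄.outA (𝔄.bHist E₀ cB)) W EA₀ κ) (hdB : DecayBound (𝔄.outB (𝔄.bHist E₀ cB)) W E₀ κ)
    (hRA : RawBounded 𝔄.F 𝔄.rawAt W) (hRB : RawBounded 𝔄.F 𝔄.rawB W)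
    (hwer : WeightedEntrywiseRate 𝔄.F 𝔄.rawAt 𝔄.rawB W c₁ fun k => θ ^ k) (hfl : ∀ k, r₀ ≤ 𝔄.rOp k)
    (hins : (𝔄.step (𝔄.bHist E₀ cB)).InsertionRate W κ E₀ δ' θ)
    (hbd : TermBound (ballClass (selfCtr 𝔄.raw 𝔄.histRef) ROp RHist) (term 𝔄.𝒯 𝔄.inc 𝔄.act) W κ a)
    (hbud : TermBudget a G) (hline : TermLineAnalytic (ballClass (selfCtr 𝔄.raw 𝔄.histRef) ROp RHist) (term 𝔄.𝒯 𝔄.inc 𝔄.act) W)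
    (hOp : ∀ k, 𝔄.rOp k ≤ ROp k) (hHist : ∀ k, 𝔄.bHist E₀ cB k + 𝔄.rHist k ≤ RHist k)
    (hE₀ : 0 ≤ E₀) (hG : 0 ≤ G) (hcA : 0 ≤ cA) (hcB : 0 ≤ cB) (hc₁ : 0 ≤ c₁) (hr₀ : 0 < r₀) (hδ' : 0 ≤ δ')
    (hθ0 : 0 < θ) (hθ1 : θ < 1) (hθθ' : θ ≤ θ') (hθ'1 : θ' ≤ 1) (hω : 0 < 𝔄.D.ω) (hω1 : 𝔄.D.ω < 1)
    (hh : cA * (EA₀ + E₀) < 1 - 𝔄.D.ω)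
    (hsmall : 𝔄.D.ω + G * cA * (1 - 𝔄.D.ω) / (1 - 𝔄.D.ω - cA * (EA₀ + E₀)) < θ') :
    ∃ C₅, NE5 (𝔄.outA (𝔄.bHist E₀ cB)) (𝔄.outB (𝔄.bHist E₀ cB)) W κ θ' C₅ := by
  obtain ⟨ρ₀, hreach, hρ₀, hs⟩ := (reach_elim_iff (mul_nonneg hG hcA) hω1).mpr ⟨hh, hsmall⟩
  obtain ⟨k₀, B, hB, hnear, hfirst⟩ :=
    reach_binders_exists (D := c₁ / r₀ + δ') (add_nonneg (div_nonneg hc₁ hr₀.le) hδ') hθ0 hθ1 hreach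
  exact ⟨_, ne5_of_assembly 𝔄 hT hbB hbA hdA hdB hRA hRB hwer hfl hins hbd hbud hline hOp hHist hE₀ one_pos hG hcA hcB hc₁ hr₀
    hδ' hθ0.le hθθ' hθ'1 hω hω1 hρ₀ hnear hB hfirst (smallness_of_gain hs)⟩

/-- [folklore] The same with W1 read in MARGIN UNITS (`OperatorRate δ θ` displayed — the tower-reading fork of row O4-r):
`B13StepEnd.ne5_of_assembly_opRate` with the letters `ρ₀, k₀, B` eliminated. -/
theorem exists_ne5_of_assembly_opRate {W : Set (ℕ → ℝ)} {ROp RHist : ℕ → ℝ} {a : ℕ → ι → ℝ}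
    {κ G EA₀ E₀ cA cB δ δ' θ θ' : ℝ}
    (hT : 𝔄.TransportReads W)
    (hbB : 𝔄.SliceBudgetB W κ cB) (hbA : 𝔄.D.SliceBudget (𝔄.step (𝔄.bHist E₀ cB)) W κ cA)
    (hdA : DecayBound (𝔄.outA (𝔄.bHist E₀ cB)) W EA₀ κ) (hdB : DecayBound (𝔄.outB (𝔄.bHist E₀ cB)) W E₀ κ)
    (hop : (𝔄.step (𝔄.bHist E₀ cB)).OperatorRate W δ θ) (hins : (𝔄.step (𝔄.bHist E₀ cB)).InsertionRate W κ E₀ δ' θ)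
    (hbd : TermBound (ballClass (selfCtr 𝔄.raw 𝔄.histRef) ROp RHist) (term 𝔄.𝒯 𝔄.inc 𝔄.act) W κ a)
    (hbud : TermBudget a G) (hline : TermLineAnalytic (ballClass (selfCtr 𝔄.raw 𝔄.histRef) ROp RHist) (term 𝔄.𝒯 𝔄.inc 𝔄.act) W)
    (hOp : ∀ k, 𝔄.rOp k ≤ ROp k) (hHist : ∀ k, 𝔄.bHist E₀ cB k + 𝔄.rHist k ≤ RHist k)
    (hE₀ : 0 ≤ E₀) (hG : 0 ≤ G) (hcA : 0 ≤ cA) (hcB : 0 ≤ cB) (hδ : 0 ≤ δ) (hδ' : 0 ≤ δ')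
    (hθ0 : 0 < θ) (hθ1 : θ < 1) (hθθ' : θ ≤ θ') (hθ'1 : θ' ≤ 1) (hω : 0 < 𝔄.D.ω) (hω1 : 𝔄.D.ω < 1)
    (hh : cA * (EA₀ + E₀) < 1 - 𝔄.D.ω)
    (hsmall : 𝔄.D.ω + G * cA * (1 - 𝔄.D.ω) / (1 - 𝔄.D.ω - cA * (EA₀ + E₀)) < θ') :
    ∃ C₅, NE5 (𝔄.outA (𝔄.bHist E₀ cB)) (𝔄.outB (𝔄.bHist E₀ cB)) W κ θ' C₅ := by
  obtain ⟨ρ₀, hreach, hρ₀, hs⟩ := (reach_elim_iff (mul_nonneg hG hcA) hω1).mpr ⟨hh, hsmall⟩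
  obtain ⟨k₀, B, hB, hnear, hfirst⟩ := reach_binders_exists (D := δ + δ') (add_nonneg hδ hδ') hθ0 hθ1 hreach
  exact ⟨_, ne5_of_assembly_opRate 𝔄 hT hbB hbA hdA hdB hop hins hbd hbud hline hOp hHist hE₀ one_pos hG hcA hcB hδ hδ' hθ0.le
    hθθ' hθ'1 hω hω1 hρ₀ hnear hB hfirst (smallness_of_gain hs)⟩

variable [CompleteSpace Hist] [NormedAddCommGroup IOp] [NormedSpace ℂ IOp]

/-- [folklore] **THE TERMWISE END FACE ON THE ASSEMBLED MODEL WITH W4 PRODUCED, ARITHMETIC LETTERS ELIMINATED** —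
`B13StepEndInsOp.ne5_of_assembly_insOp` with `ρ₀, k₀, B` AND the insertion species' reach letters `ρ₁, k₁` eliminated (`ρ₁ := ½`,
`k₁` from `insReach_exists`): the insertion-operator species' displayed envelope `InsOpEnvelope κ E₀ Gi` ∧ bound `InsBoundA κ E₀ Gi`
(ONE-RUN, W2-ins class) and two-run rate `InsOpRate δI θ` (NE2-TYPE) enter with `0 ≤ Gi`, `0 ≤ δI` only. -/
theorem exists_ne5_of_assembly_insOp {W : Set (ℕ → ℝ)} {ROp RHist : ℕ → ℝ} {a : ℕ → ι → ℝ}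
    {κ G EA₀ E₀ cA cB c₁ r₀ Gi δI θ θ' : ℝ} (rI : ℕ → ℝ) (hrI : ∀ k, 0 < rI k)
    (hT : 𝔄.TransportReads W)
    (hbB : 𝔄.SliceBudgetB W κ cB) (hbA : 𝔄.D.SliceBudget (𝔄.step (𝔄.bHist E₀ cB)) W κ cA)
    (hdA : DecayBound (𝔄.outA (𝔄.bHist E₀ cB)) W EA₀ κ) (hdB : DecayBound (𝔄.outB (𝔄.bHist E₀ cB)) W E₀ κ)
    (hRA : RawBounded 𝔄.F 𝔄.rawAt W) (hRB : RawBounded 𝔄.F 𝔄.rawB W)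
    (hwer : WeightedEntrywiseRate 𝔄.F 𝔄.rawAt 𝔄.rawB W c₁ fun k => θ ^ k) (hfl : ∀ k, r₀ ≤ 𝔄.rOp k)
    (hienv : (𝔄.D.toInsOpModel (𝔄.step (𝔄.bHist E₀ cB)) rI hrI).InsOpEnvelope W κ E₀ Gi)
    (hibdA : (𝔄.D.toInsOpModel (𝔄.step (𝔄.bHist E₀ cB)) rI hrI).InsBoundA W κ E₀ Gi)
    (hirate : (𝔄.D.toInsOpModel (𝔄.step (𝔄.bHist E₀ cB)) rI hrI).InsOpRate W δI θ) (hδI : 0 ≤ δI) (hGi : 0 ≤ Gi)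
    (hbd : TermBound (ballClass (selfCtr 𝔄.raw 𝔄.histRef) ROp RHist) (term 𝔄.𝒯 𝔄.inc 𝔄.act) W κ a)
    (hbud : TermBudget a G) (hline : TermLineAnalytic (ballClass (selfCtr 𝔄.raw 𝔄.histRef) ROp RHist) (term 𝔄.𝒯 𝔄.inc 𝔄.act) W)
    (hOp : ∀ k, 𝔄.rOp k ≤ ROp k) (hHist : ∀ k, 𝔄.bHist E₀ cB k + 𝔄.rHist k ≤ RHist k)
    (hE₀ : 0 ≤ E₀) (hG : 0 ≤ G) (hcA : 0 ≤ cA) (hcB : 0 ≤ cB) (hc₁ : 0 ≤ c₁) (hr₀ : 0 < r₀)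
    (hθ0 : 0 < θ) (hθ1 : θ < 1) (hθθ' : θ ≤ θ') (hθ'1 : θ' ≤ 1) (hω : 0 < 𝔄.D.ω) (hω1 : 𝔄.D.ω < 1)
    (hh : cA * (EA₀ + E₀) < 1 - 𝔄.D.ω)
    (hsmall : 𝔄.D.ω + G * cA * (1 - 𝔄.D.ω) / (1 - 𝔄.D.ω - cA * (EA₀ + E₀)) < θ') :
    ∃ C₅, NE5 (𝔄.outA (𝔄.bHist E₀ cB)) (𝔄.outB (𝔄.bHist E₀ cB)) W κ θ' C₅ := by
  obtain ⟨ρ₀, hreach, hρ₀, hs⟩ := (reach_elim_iff (mul_nonneg hG hcA) hω1).mpr ⟨hh, hsmall⟩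
  obtain ⟨k₁, hk₁⟩ := insReach_exists hδI hθ1
  have hρ₁ : (1 : ℝ) / 2 < 1 := by norm_num
  obtain ⟨k₀, B, hB, hnear, hfirst⟩ :=
    reach_binders_exists (D := c₁ / r₀ + (Gi * δI / (1 - 1 / 2) + 2 * Gi / θ ^ k₁))
      (add_nonneg (div_nonneg hc₁ hr₀.le) (deltaIns_nonneg hGi hδI hθ0 hρ₁)) hθ0 hθ1 hreach
  exact ⟨_, ne5_of_assembly_insOp 𝔄 rI hrI hT hbB hbA hdA hdB hRA hRB hwer hfl hienv hibdA hirate hδI hGi hρ₁ hk₁ hbd hbud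
    hline hOp hHist hE₀ one_pos hG hcA hcB hc₁ hr₀ hθ0 hθθ' hθ'1 hω hω1 hρ₀ hnear hB hfirst (smallness_of_gain hs)⟩

end Assembled

/-! ## §3 On Bałaban's paired-torus carriers OF RECORD: one constant for every pair of runs -/

section OfRecord

/-- [folklore] **NE5 ON THE CARRIERS OF RECORD WITH A CONSTANT UNIFORM IN THE PAIR OF RUNS, ARITHMETIC LETTERS ELIMINATED.**
Fix the displayed SIZES — decay rate `κ`, budget `G`, one-run levels `EA₀, E₀`, slice constants `cA, cB`, row NE2's entry
constant `c₁` and margin floor `r₀`, W4's `δ′`, the input rate `0 < θ < 1`, the target rate `θ ≤ θ′ ≤ 1`, the age damping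
`0 < ω < 1` — subject to the two strict size inequalities `cA(EA₀ + E₀) < 1 − ω` and `ω + G·cA·(1 − ω)∕(1 − ω − cA(EA₀ + E₀)) < θ′`.
Then ONE constant `C₅` serves EVERY pair of runs `R : B13Carriers.TwoRuns 𝔾` (every pair of lattice spacings), every slot package
`S : B13StepOfRecord.Slots R E IOp Hist` with age damping `S.D.ω = ω`, every window `W` and every roomy class `ROp, RHist, a`: the
displayed analytic binders of `B13StepEnd.ne5_of_assembly` at `B13StepOfRecord.assembly S` (reading `TransportReads`; the two
one-run slice budgets; `DecayBound (outA S E₀ cB) W EA₀ κ` ∕ `DecayBound (outB S E₀ cB) W E₀ κ`; `RawBounded` ×2 +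
`WeightedEntrywiseRate … c₁ θ^k` + floor `r₀`; `InsertionRate W κ E₀ δ′ θ`; the termwise W2 data on
`ballClass (selfCtr raw histRef) ROp RHist`; room ×2) IMPLY `NE5 (outA S E₀ cB) (outB S E₀ cB) W κ θ′ C₅`.  The η-uniformity of
the constant is the quantifier order `∃ C₅, ∀ R S W …`.  NOT a proof of NE5: an implication from displayed binders. -/
theorem uniform_ne5_of_record {κ G EA₀ E₀ cA cB c₁ r₀ δ' θ θ' ω : ℝ}
    (hE₀ : 0 ≤ E₀) (hG : 0 ≤ G) (hcA : 0 ≤ cA) (hcB : 0 ≤ cB) (hc₁ : 0 ≤ c₁) (hr₀ : 0 < r₀) (hδ' : 0 ≤ δ')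
    (hθ0 : 0 < θ) (hθ1 : θ < 1) (hθθ' : θ ≤ θ') (hθ'1 : θ' ≤ 1) (hω : 0 < ω) (hω1 : ω < 1)
    (hh : cA * (EA₀ + E₀) < 1 - ω) (hsmall : ω + G * cA * (1 - ω) / (1 - ω - cA * (EA₀ + E₀)) < θ') :
    ∃ C₅ : ℝ, ∀ {𝔾 : Type} [GaugeGroup 𝔾] {R : TwoRuns 𝔾} {E IOp Hist : Type*} [NormedAddCommGroup Hist] [NormedSpace ℂ Hist]
      (S : Slots R E IOp Hist) {W : Set (ℕ → ℝ)} {ROp RHist : ℕ → ℝ} {a : ℕ → TermIdx R.carriers.Dom (Bnd R) → ℝ},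
      S.D.ω = ω →
      (assembly S).TransportReads W →
      (assembly S).SliceBudgetB W κ cB → S.D.SliceBudget (step S E₀ cB) W κ cA →
      DecayBound (outA S E₀ cB) W EA₀ κ → DecayBound (outB S E₀ cB) W E₀ κ →
      RawBounded S.F (assembly S).rawAt W → RawBounded S.F S.rawB W →
      WeightedEntrywiseRate S.F (assembly S).rawAt S.rawB W c₁ (fun k => θ ^ k) → (∀ k, r₀ ≤ S.rOp k) →
      (step S E₀ cB).InsertionRate W κ E₀ δ' θ →
      TermBound (ballClass (selfCtr (assembly S).raw (assembly S).histRef) ROp RHist)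
        (term (assembly S).𝒯 (assembly S).inc S.act) W κ a →
      TermBudget a G →
      TermLineAnalytic (ballClass (selfCtr (assembly S).raw (assembly S).histRef) ROp RHist)
        (term (assembly S).𝒯 (assembly S).inc S.act) W →
      (∀ k, S.rOp k ≤ ROp k) → (∀ k, (assembly S).bHist E₀ cB k + S.rHist k ≤ RHist k) →
      NE5 (outA S E₀ cB) (outB S E₀ cB) W κ θ' C₅ := by
  obtain ⟨ρ₀, hreach, hρ₀, hs⟩ := (reach_elim_iff (mul_nonneg hG hcA) hω1).mpr ⟨hh, hsmall⟩
  obtain ⟨k₀, B, hB, hnear, hfirst⟩ :=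
    reach_binders_exists (D := c₁ / r₀ + δ') (add_nonneg (div_nonneg hc₁ hr₀.le) hδ') hθ0 hθ1 hreach
  refine ⟨(G / (1 - ρ₀) * (c₁ / r₀) + G / (1 - ρ₀) * δ' + B) * (θ' - ω) / (θ' - (ω + G / (1 - ρ₀) * cA)), ?_⟩
  intro 𝔾 _ R E IOp Hist _ _ S W ROp RHist a hSω hT hbB hbA hdA hdB hRA hRB hwer hfl hins hbd hbud hline hOp hHist
  subst hSω
  exact ne5_of_assembly (assembly S) hT hbB hbA hdA hdB hRA hRB hwer hfl hins hbd hbud hline hOp hHist hE₀ one_pos hG hcA hcB hc₁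
    hr₀ hδ' hθ0.le hθθ' hθ'1 hω hω1 hρ₀ hnear hB hfirst (smallness_of_gain hs)

/-- [folklore] **THE SAME WITH W4 PRODUCED from the insertion-operator species** (`B13StepEndInsOp.ne5_of_assembly_insOp` at the
assembly of record): the sizes `Gi, δI ≥ 0` of the species' displayed one-run envelope ∕ bound and two-run rate replace `δ′`; the
species' reach letters `ρ₁, k₁` are eliminated too (`ρ₁ := ½`); ONE constant for every pair of runs, slot package (`S.D.ω = ω`),
insertion margin `rI`, window and roomy class. -/
theorem uniform_ne5_of_record_insOp {κ G EA₀ E₀ cA cB c₁ r₀ Gi δI θ θ' ω : ℝ}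
    (hE₀ : 0 ≤ E₀) (hG : 0 ≤ G) (hcA : 0 ≤ cA) (hcB : 0 ≤ cB) (hc₁ : 0 ≤ c₁) (hr₀ : 0 < r₀) (hGi : 0 ≤ Gi)
    (hδI : 0 ≤ δI) (hθ0 : 0 < θ) (hθ1 : θ < 1) (hθθ' : θ ≤ θ') (hθ'1 : θ' ≤ 1) (hω : 0 < ω) (hω1 : ω < 1)
    (hh : cA * (EA₀ + E₀) < 1 - ω) (hsmall : ω + G * cA * (1 - ω) / (1 - ω - cA * (EA₀ + E₀)) < θ') :
    ∃ C₅ : ℝ, ∀ {𝔾 : Type} [GaugeGroup 𝔾] {R : TwoRuns 𝔾} {E IOp Hist : Type*} [NormedAddCommGroup Hist] [NormedSpace ℂ Hist]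
      [CompleteSpace Hist] [NormedAddCommGroup IOp] [NormedSpace ℂ IOp]
      (S : Slots R E IOp Hist) {W : Set (ℕ → ℝ)} {ROp RHist : ℕ → ℝ} {a : ℕ → TermIdx R.carriers.Dom (Bnd R) → ℝ}
      (rI : ℕ → ℝ) (hrI : ∀ k, 0 < rI k),
      S.D.ω = ω →
      (assembly S).TransportReads W →
      (assembly S).SliceBudgetB W κ cB → S.D.SliceBudget (step S E₀ cB) W κ cA →
      DecayBound (outA S E₀ cB) W EA₀ κ → DecayBound (outB S E₀ cB) W E₀ κ →
      RawBounded S.F (assembly S).rawAt W → RawBounded S.F S.rawB W →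
      WeightedEntrywiseRate S.F (assembly S).rawAt S.rawB W c₁ (fun k => θ ^ k) → (∀ k, r₀ ≤ S.rOp k) →
      (S.D.toInsOpModel (step S E₀ cB) rI hrI).InsOpEnvelope W κ E₀ Gi →
      (S.D.toInsOpModel (step S E₀ cB) rI hrI).InsBoundA W κ E₀ Gi →
      (S.D.toInsOpModel (step S E₀ cB) rI hrI).InsOpRate W δI θ →
      TermBound (ballClass (selfCtr (assembly S).raw (assembly S).histRef) ROp RHist)
        (term (assembly S).𝒯 (assembly S).inc S.act) W κ a →
      TermBudget a G →
      TermLineAnalytic (ballClass (selfCtr (assembly S).raw (assembly S).histRef) ROp RHist)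
        (term (assembly S).𝒯 (assembly S).inc S.act) W →
      (∀ k, S.rOp k ≤ ROp k) → (∀ k, (assembly S).bHist E₀ cB k + S.rHist k ≤ RHist k) →
      NE5 (outA S E₀ cB) (outB S E₀ cB) W κ θ' C₅ := by
  obtain ⟨ρ₀, hreach, hρ₀, hs⟩ := (reach_elim_iff (mul_nonneg hG hcA) hω1).mpr ⟨hh, hsmall⟩
  obtain ⟨k₁, hk₁⟩ := insReach_exists hδI hθ1
  have hρ₁ : (1 : ℝ) / 2 < 1 := by norm_num
  obtain ⟨k₀, B, hB, hnear, hfirst⟩ :=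
    reach_binders_exists (D := c₁ / r₀ + (Gi * δI / (1 - 1 / 2) + 2 * Gi / θ ^ k₁))
      (add_nonneg (div_nonneg hc₁ hr₀.le) (deltaIns_nonneg hGi hδI hθ0 hρ₁)) hθ0 hθ1 hreach
  refine ⟨(G / (1 - ρ₀) * (c₁ / r₀) + G / (1 - ρ₀) * (Gi * δI / (1 - 1 / 2) + 2 * Gi / θ ^ k₁) + B) * (θ' - ω) /
    (θ' - (ω + G / (1 - ρ₀) * cA)), ?_⟩
  intro 𝔾 _ R E IOp Hist _ _ _ _ _ S W ROp RHist a rI hrI hSω hT hbB hbA hdA hdB hRA hRB hwer hfl hienv hibdA hirate hbd hbud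
    hline hOp hHist
  subst hSω
  exact ne5_of_assembly_insOp (assembly S) rI hrI hT hbB hbA hdA hdB hRA hRB hwer hfl hienv hibdA hirate hδI hGi hρ₁ hk₁ hbd
    hbud hline hOp hHist hE₀ one_pos hG hcA hcB hc₁ hr₀ hθ0 hθθ' hθ'1 hω hω1 hρ₀ hnear hB hfirst (smallness_of_gain hs)

variable {𝔾 : Type} [GaugeGroup 𝔾] {R : TwoRuns 𝔾} {E IOp Hist : Type*} [NormedAddCommGroup Hist] [NormedSpace ℂ Hist]
  (S : Slots R E IOp Hist) (E₀ cB : ℝ)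

/-- [folklore] **PER PAIR OF RUNS**: the termwise END face on the carriers of record (`B13StepEnd.ne5_of_assembly` at
`B13StepOfRecord.assembly S`) with the arithmetic letters eliminated — `∃ C₅, NE5 (outA S E₀ cB) (outB S E₀ cB) W κ θ′ C₅` at the
prescribed rate from the displayed analytic binders, `0 < θ < 1`, `θ ≤ θ′ ≤ 1` and the two strict size inequalities. -/
theorem exists_ne5_of_record {W : Set (ℕ → ℝ)} {ROp RHist : ℕ → ℝ} {a : ℕ → TermIdx R.carriers.Dom (Bnd R) → ℝ}
    {κ G EA₀ cA c₁ r₀ δ' θ θ' : ℝ}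
    (hT : (assembly S).TransportReads W)
    (hbB : (assembly S).SliceBudgetB W κ cB) (hbA : S.D.SliceBudget (step S E₀ cB) W κ cA)
    (hdA : DecayBound (outA S E₀ cB) W EA₀ κ) (hdB : DecayBound (outB S E₀ cB) W E₀ κ)
    (hRA : RawBounded S.F (assembly S).rawAt W) (hRB : RawBounded S.F S.rawB W)
    (hwer : WeightedEntrywiseRate S.F (assembly S).rawAt S.rawB W c₁ fun k => θ ^ k) (hfl : ∀ k, r₀ ≤ S.rOp k)
    (hins : (step S E₀ cB).InsertionRate W κ E₀ δ' θ)
    (hbd : TermBound (ballClass (selfCtr (assembly S).raw (assembly S).histRef) ROp RHist)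
      (term (assembly S).𝒯 (assembly S).inc S.act) W κ a)
    (hbud : TermBudget a G)
    (hline : TermLineAnalytic (ballClass (selfCtr (assembly S).raw (assembly S).histRef) ROp RHist)
      (term (assembly S).𝒯 (assembly S).inc S.act) W)
    (hOp : ∀ k, S.rOp k ≤ ROp k) (hHist : ∀ k, (assembly S).bHist E₀ cB k + S.rHist k ≤ RHist k)
    (hE₀ : 0 ≤ E₀) (hG : 0 ≤ G) (hcA : 0 ≤ cA) (hcB : 0 ≤ cB) (hc₁ : 0 ≤ c₁) (hr₀ : 0 < r₀) (hδ' : 0 ≤ δ')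
    (hθ0 : 0 < θ) (hθ1 : θ < 1) (hθθ' : θ ≤ θ') (hθ'1 : θ' ≤ 1) (hω : 0 < S.D.ω) (hω1 : S.D.ω < 1)
    (hh : cA * (EA₀ + E₀) < 1 - S.D.ω)
    (hsmall : S.D.ω + G * cA * (1 - S.D.ω) / (1 - S.D.ω - cA * (EA₀ + E₀)) < θ') :
    ∃ C₅, NE5 (outA S E₀ cB) (outB S E₀ cB) W κ θ' C₅ :=
  exists_ne5_of_assembly (assembly S) hT hbB hbA hdA hdB hRA hRB hwer hfl hins hbd hbud hline hOp hHist hE₀ hG hcA hcB hc₁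
    hr₀ hδ' hθ0 hθ1 hθθ' hθ'1 hω hω1 hh hsmall

/-- [folklore] **PER PAIR OF RUNS, W4 PRODUCED**: `B13StepEndInsOp.ne5_of_record_insOp` with the letters `ρ₀, k₀, B, ρ₁, k₁`
eliminated. -/
theorem exists_ne5_of_record_insOp [CompleteSpace Hist] [NormedAddCommGroup IOp] [NormedSpace ℂ IOp]
    {W : Set (ℕ → ℝ)} {ROp RHist : ℕ → ℝ} {a : ℕ → TermIdx R.carriers.Dom (Bnd R) → ℝ}
    {κ G EA₀ cA c₁ r₀ Gi δI θ θ' : ℝ} (rI : ℕ → ℝ) (hrI : ∀ k, 0 < rI k)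
    (hT : (assembly S).TransportReads W)
    (hbB : (assembly S).SliceBudgetB W κ cB) (hbA : S.D.SliceBudget (step S E₀ cB) W κ cA)
    (hdA : DecayBound (outA S E₀ cB) W EA₀ κ) (hdB : DecayBound (outB S E₀ cB) W E₀ κ)
    (hRA : RawBounded S.F (assembly S).rawAt W) (hRB : RawBounded S.F S.rawB W)
    (hwer : WeightedEntrywiseRate S.F (assembly S).rawAt S.rawB W c₁ fun k => θ ^ k) (hfl : ∀ k, r₀ ≤ S.rOp k)
    (hienv : (S.D.toInsOpModel (step S E₀ cB) rI hrI).InsOpEnvelope W κ E₀ Gi)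
    (hibdA : (S.D.toInsOpModel (step S E₀ cB) rI hrI).InsBoundA W κ E₀ Gi)
    (hirate : (S.D.toInsOpModel (step S E₀ cB) rI hrI).InsOpRate W δI θ) (hδI : 0 ≤ δI) (hGi : 0 ≤ Gi)
    (hbd : TermBound (ballClass (selfCtr (assembly S).raw (assembly S).histRef) ROp RHist)
      (term (assembly S).𝒯 (assembly S).inc S.act) W κ a)
    (hbud : TermBudget a G)
    (hline : TermLineAnalytic (ballClass (selfCtr (assembly S).raw (assembly S).histRef) ROp RHist)
      (term (assembly S).𝒯 (assembly S).inc S.act) W)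
    (hOp : ∀ k, S.rOp k ≤ ROp k) (hHist : ∀ k, (assembly S).bHist E₀ cB k + S.rHist k ≤ RHist k)
    (hE₀ : 0 ≤ E₀) (hG : 0 ≤ G) (hcA : 0 ≤ cA) (hcB : 0 ≤ cB) (hc₁ : 0 ≤ c₁) (hr₀ : 0 < r₀)
    (hθ0 : 0 < θ) (hθ1 : θ < 1) (hθθ' : θ ≤ θ') (hθ'1 : θ' ≤ 1) (hω : 0 < S.D.ω) (hω1 : S.D.ω < 1)
    (hh : cA * (EA₀ + E₀) < 1 - S.D.ω)
    (hsmall : S.D.ω + G * cA * (1 - S.D.ω) / (1 - S.D.ω - cA * (EA₀ + E₀)) < θ') :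
    ∃ C₅, NE5 (outA S E₀ cB) (outB S E₀ cB) W κ θ' C₅ :=
  exists_ne5_of_assembly_insOp (assembly S) rI hrI hT hbB hbA hdA hdB hRA hRB hwer hfl hienv hibdA hirate hδI hGi hbd hbud
    hline hOp hHist hE₀ hG hcA hcB hc₁ hr₀ hθ0 hθ1 hθθ' hθ'1 hω hω1 hh hsmall

end OfRecord

end Summit.QuantumFields.BalabanUV.T4Continuum.B13StepEndArithmetic

end
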